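import Summits.CriticalPhenomena.PercolationContinuityZ3.Theorems.SahiMasterFamilyFInequalityAMSLinearForm
import Summits.CriticalPhenomena.PercolationContinuityZ3.Theorems.SahiMasterFamilyFInequalityAMSCases
import Summits.CriticalPhenomena.PercolationContinuityZ3.Theorems.SahiMasterFamilyFInequalityMSLinear

/-!
# Conjecture (LA) holds for bipartite class graphs (the Marica–Schönheim case of the rank conjecture)

Support file for the master-family `F`-inequality programme (`prim-master-conj` gen 26; `--supports stmt-CriticalPhenomena-4575`;
memo `run/shared/lean/prim/prim-l12/prim-master-conj/POINTWISE.md` §27, `LA-CONJECTURE.md`).  No definition, no `sorry`, standard axioms.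

`TwistedAD.LARank` (`…AMSLinearForm`) conjectures `#S ≤ 2 · rank_ℚ (laMatrix S R)` for every complement-closed `S` and every equivalence relation `R`
with `¬R x xᶜ` on `S`, where `laMatrix S R = (𝟙[wᶜ ⊆ u])_{w ∈ S, u ∈ J(S,R)}`.  Here the conjectured inequality is PROVED whenever `R` refines an
antipodal two-colouring `f` of `S` (`f xᶜ ≠ f x`, `R x z → f x = f z`; for an equivalence relation: the class graph is bipartite — in particular for
two classes), for an ARBITRARY relation `R`:

* `card_le_two_mul_rank_laMatrix_of_twoColouring`.

Proof: with `P = {x ∈ S : f x}` one has `S ⊆ P ∪ Pᶜˢ`, all pairs in `P × P` are cross-admissible, so `(P \\ P)ᶜˢ ⊆ J(S,R)`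
(`compls_diffs_subset_amsUnions`), and the submatrix of `laMatrix S R` on rows `P` and columns `(P \\ P)ᶜˢ` is the containment matrix
`(𝟙[e ⊆ p])_{p ∈ P, e ∈ P \\ P}`, which has rank `#P` by the linear-algebra Marica–Schönheim theorem `rank_subset_diffs_eq_card` (`…MSLinear`).
Hence `#S ≤ 2#P ≤ 2·rank`.  So the open content of (LA), like that of (AMS), is the non-bipartite case. [this work]
-/

namespace Summit.CriticalPhenomena.PercolationContinuityZ3.Theorems

namespace TwistedAD

open Finset Matrix
open scoped FinsetFamily Classical

variable {κ : Type*} [Fintype κ] [DecidableEq κ]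

/-- **(LA) for relations refining an antipodal two-colouring.**  If `S` is complement-closed, `f : Finset κ → Bool` satisfies `f xᶜ ≠ f x` on `S`
and `R x z → f x = f z` for `x, z ∈ S`, then `#S ≤ 2 · rank_ℚ (laMatrix S R)`. [this work] -/
theorem card_le_two_mul_rank_laMatrix_of_twoColouring (S : Finset (Finset κ)) (R : Finset κ → Finset κ → Prop)
    (hScl : ∀ x ∈ S, xᶜ ∈ S) (f : Finset κ → Bool) (hf : ∀ x ∈ S, f xᶜ ≠ f x)
    (hRf : ∀ x ∈ S, ∀ z ∈ S, R x z → f x = f z) :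
    S.card ≤ 2 * (laMatrix S R).rank := by
  set P := S.filter (fun x => f x = true) with hP
  have hPS : P ⊆ S := filter_subset _ _
  -- all pairs of `P` are cross-admissible
  have hadm : ∀ w ∈ P, ∀ x ∈ P, ¬ R wᶜ x ∧ ¬ R w xᶜ := by
    intro w hw x hx
    obtain ⟨hwS, hfw⟩ := mem_filter.1 hw
    obtain ⟨hxS, hfx⟩ := mem_filter.1 hx
    have hwc : f wᶜ = false := by
      have hne := hf w hwS
      rw [hfw] at hne
      cases h : f wᶜ with
      | true => exact absurd h hne
      | false => rfl
    have hxc : f xᶜ = false := by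
      have hne := hf x hxS
      rw [hfx] at hne
      cases h : f xᶜ with
      | true => exact absurd h hne
      | false => rfl
    refine ⟨fun h => ?_, fun h => ?_⟩
    · have := hRf wᶜ (hScl w hwS) x hxS h
      rw [hwc, hfx] at this
      exact Bool.false_ne_true this
    · have := hRf w hwS xᶜ (hScl x hxS) h
      rw [hfw, hxc] at this
      exact Bool.false_ne_true this.symm
  have hsub : (P \\ P)ᶜˢ ⊆ amsUnions S R := compls_diffs_subset_amsUnions S R hScl P P hPS hPS hadm
  -- `#S ≤ 2 #P`
  have hcov : S ⊆ P ∪ Pᶜˢ := by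
    intro x hx
    by_cases hfx : f x = true
    · exact mem_union.2 (Or.inl (mem_filter.2 ⟨hx, hfx⟩))
    · refine mem_union.2 (Or.inr (mem_compls.2 (mem_filter.2 ⟨hScl x hx, ?_⟩)))
      have hne := hf x hx
      cases h : f xᶜ with
      | true => rfl
      | false =>
        exfalso
        rw [h] at hne
        cases h' : f x with
        | true => exact hfx h'
        | false => exact hne (by rw [h'])
  have hcardS : S.card ≤ 2 * P.card := by
    calc S.card ≤ (P ∪ Pᶜˢ).card := card_le_card hcov
      _ ≤ P.card + Pᶜˢ.card := card_union_le _ _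
      _ = 2 * P.card := by rw [card_compls]; ring
  -- the submatrix of `laMatrix S R` on rows `P`, columns `(P \\ P)ᶜˢ` is the containment matrix of `P` against `P \\ P`
  let r : ↥P → ↥S := fun p => ⟨(p : Finset κ), hPS p.2⟩
  have hc : ∀ d : ↥(P \\ P), (d : Finset κ)ᶜ ∈ amsUnions S R := fun d =>
    hsub (mem_compls.2 (by rw [compl_compl]; exact d.2))
  let c : ↥(P \\ P) → ↥(amsUnions S R) := fun d => ⟨(d : Finset κ)ᶜ, hc d⟩
  have hsubm : (laMatrix S R).submatrix r c
      = Matrix.of fun (a : ↥P) (e : ↥(P \\ P)) => if (e : Finset κ) ⊆ (a : Finset κ) then (1 : ℚ) else 0 := by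
    ext a e
    simp only [laMatrix, Matrix.submatrix_apply, Matrix.of_apply, r, c, compl_subset_compl]
  have hrankP : ((laMatrix S R).submatrix r c).rank = P.card := by
    rw [hsubm]; exact rank_subset_diffs_eq_card P
  have hle : P.card ≤ (laMatrix S R).rank := by
    rw [← hrankP]; exact Matrix.rank_submatrix_le _ _ _
  omega

end TwistedAD

end Summit.CriticalPhenomena.PercolationContinuityZ3.Theorems
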